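import Summits.CriticalPhenomena.PercolationContinuityZ3.Theorems.PercNearOneGluingNoHeavyLowerTailTwoPartitionSplit
import Mathlib.Logic.Equiv.Fin.Basic
import Mathlib.Logic.Equiv.Option
import Mathlib.Data.Fin.SuccPred
import HarnessLib.Audit

/-!
# `NoHeavyLowerTail` (crux stmt-CriticalPhenomena-4575), master-family hierarchy P3 (gen 30): PEELING an arbitrary coordinate —
# the one-coordinate split of `threeSetN` at any `i : Fin (n+1)`, and `ThreeSetAntipodal` for every up-set with at most TWO minimal
# elements (`𝒜 = {S : a ⊆ S ∨ b ⊆ S}`, all `n, a, b`, arbitrary up-sets `ℬ, 𝒞`)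

Support file (seat `prim-masterthm-p3`; `--supports stmt-CriticalPhenomena-4575`; memo
`run/shared/lean/prim/prim-masterthm/FROM-prim-masterthm-p3-g30-SPLIT-AND-PEELING.md`, HIERARCHY §37).  Companion of
`…TwoPartitionSplit` (`threeSetN_fib_add_fib_le`, `threeSetN_nonneg_of_fib`: the split along the `Unit` summand of `ι ⊕ Unit`).

PEELING AT `i` (this work).  Along the equivalence `E_i = (finSuccEquiv' i).trans (optionEquivSumPUnit _) : Fin (n+1) ≃ Fin n ⊕ Unit`
(`i ↦ inr ()`, `i.succAbove j ↦ inl j`) the two layers of a family `𝒜 ⊆ 2^[n+1]` are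
`𝒜_i⁰ = {e ⊆ [n] : e.map (succAbove i) ∈ 𝒜}` and `𝒜_i¹ = {e : insert i (e.map (succAbove i)) ∈ 𝒜}` (`mem_fib_splitAt_empty/univ`), and
**`threeSetN_nonneg_of_peel`**: if the jump set `𝒜_i¹ ∖ 𝒜_i⁰` is complement-free then `ThreeSetAntipodal` for the two layer triples
implies it for `(𝒜, ℬ, 𝒞)`.  Recursive use ("peelability"): an up-set is settled if it is complement-free, or `univ`, or some coordinate
peels it into two settled layers.  CENSUS (evidence, `code-g30/peelclass.py`): EVERY up-set of `2^[n]`, `n ≤ 4`, is recursively peelable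
(so the split settles `ThreeSetAntipodal` for all `𝒜` on at most four points, kernel-checkable instance by instance), and 7 019 of the
7 581 up-sets of `2^[5]`; the 562 exceptions are exactly the up-sets with NO peelable coordinate ("pinched": every coordinate is the exact
intersection of two minimal elements, or a singleton minimal element meeting the others badly).

TWO GENERATORS (this work, unconditional): **`threeSetN_twoGen_nonneg`** — for all `n`, all `a, b ⊆ [n]` and all up-sets `ℬ, 𝒞`,
`0 ≤ threeSetN {S : a ⊆ S ∨ b ⊆ S} ℬ 𝒞`.  (If `a ∩ b ≠ ∅` the family is complement-free; if `a = ∅` or `b = ∅` it is `univ`; otherwise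
peel a coordinate `i ∈ a` with `#b ≤ #a`: the lower layer is principal (`{b' ⊆ e}`), the upper layer is the two-generator family of
`(a ∖ i, b)` pulled back to `[n]`, and the jump set `{a' ⊆ e, b' ⊄ e}` is complement-free because `a' ≠ ∅` or `#b' ≤ 1`; induction on `n`.)
This contains the equality case `𝒜 = {x₁} ∨ {x₂}` of `SQKD` and all unions of two subcubes, in every dimension.
HONEST LABEL: structural lemmas and one more infinite family; `ThreeSetAntipodal` stays OPEN (first unsettled instances: the 562 pinched
up-sets of `2^[5]`, all verified numerically, gens 25–26). [this work]
-/

namespace Summit.CriticalPhenomena.PercolationContinuityZ3.Theorems.TwoPartition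

open Finset
open scoped FinsetFamily

section Peel

variable {n : ℕ}

/-- The peeling equivalence sends `inl j` back to `i.succAbove j`. [this work] -/
theorem splitAt_symm_inl (i : Fin (n + 1)) (j : Fin n) :
    ((finSuccEquiv' i).trans (Equiv.optionEquivSumPUnit.{0, 0} (Fin n))).symm (Sum.inl j) = i.succAbove j := by
  simp [Equiv.optionEquivSumPUnit_symm_inl, finSuccEquiv'_symm_some]

/-- The peeling equivalence sends `inr ()` back to `i`. [this work] -/
theorem splitAt_symm_inr (i : Fin (n + 1)) (u : Unit) :
    ((finSuccEquiv' i).trans (Equiv.optionEquivSumPUnit.{0, 0} (Fin n))).symm (Sum.inr u) = i := by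
  simp [Equiv.optionEquivSumPUnit_symm_inr, finSuccEquiv'_symm_none]

/-- Transport of a layer point: `(e ⊎ q).map E_i.symm = e.map (succAbove i) ∪ [q ≠ ∅]·{i}`, membership form. [this work] -/
theorem mem_map_splitAt_symm (i : Fin (n + 1)) (e : Finset (Fin n)) (q : Finset Unit) (x : Fin (n + 1)) :
    x ∈ (e.disjSum q).map ((finSuccEquiv' i).trans (Equiv.optionEquivSumPUnit.{0, 0} (Fin n))).symm.toEmbedding ↔
      x ∈ e.map (Fin.succAboveEmb i) ∨ (x = i ∧ () ∈ q) := by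
  rw [mem_map_equiv, Equiv.symm_symm, mem_disjSum, Finset.mem_map]
  constructor
  · rintro (⟨a, ha, hax⟩ | ⟨u, hu, hux⟩)
    · left
      refine ⟨a, ha, ?_⟩
      have h := (Equiv.symm_apply_eq ((finSuccEquiv' i).trans (Equiv.optionEquivSumPUnit.{0, 0} (Fin n)))).2 hax
      rw [splitAt_symm_inl] at h
      exact h
    · right
      have h := (Equiv.symm_apply_eq ((finSuccEquiv' i).trans (Equiv.optionEquivSumPUnit.{0, 0} (Fin n)))).2 hux
      rw [splitAt_symm_inr] at h
      cases u
      exact ⟨h.symm, hu⟩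
  · rintro (⟨a, ha, hax⟩ | ⟨hxi, hu⟩)
    · left
      refine ⟨a, ha, ?_⟩
      have h : ((finSuccEquiv' i).trans (Equiv.optionEquivSumPUnit.{0, 0} (Fin n))).symm (Sum.inl a) = x := by
        rw [splitAt_symm_inl]; exact hax
      exact (Equiv.symm_apply_eq _).1 h
    · right
      refine ⟨(), hu, ?_⟩
      have h : ((finSuccEquiv' i).trans (Equiv.optionEquivSumPUnit.{0, 0} (Fin n))).symm (Sum.inr ()) = x := by
        rw [splitAt_symm_inr]; exact hxi.symm
      exact (Equiv.symm_apply_eq _).1 h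

/-- The lower layer at `i`: `e ∈ 𝒜_i⁰ ↔ e.map (succAbove i) ∈ 𝒜`. [this work] -/
theorem mem_fib_splitAt_empty (i : Fin (n + 1)) (𝒜 : Finset (Finset (Fin (n + 1)))) (e : Finset (Fin n)) :
    e ∈ fib (famMap ((finSuccEquiv' i).trans (Equiv.optionEquivSumPUnit.{0, 0} (Fin n))) 𝒜) (∅ : Finset Unit) ↔
      e.map (Fin.succAboveEmb i) ∈ 𝒜 := by
  rw [mem_fib, mem_famMap]
  have h : (e.disjSum (∅ : Finset Unit)).map ((finSuccEquiv' i).trans (Equiv.optionEquivSumPUnit.{0, 0} (Fin n))).symm.toEmbedding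
      = e.map (Fin.succAboveEmb i) := by
    ext x; rw [mem_map_splitAt_symm]; simp
  rw [h]

/-- The upper layer at `i`: `e ∈ 𝒜_i¹ ↔ insert i (e.map (succAbove i)) ∈ 𝒜`. [this work] -/
theorem mem_fib_splitAt_univ (i : Fin (n + 1)) (𝒜 : Finset (Finset (Fin (n + 1)))) (e : Finset (Fin n)) :
    e ∈ fib (famMap ((finSuccEquiv' i).trans (Equiv.optionEquivSumPUnit.{0, 0} (Fin n))) 𝒜) (univ : Finset Unit) ↔
      insert i (e.map (Fin.succAboveEmb i)) ∈ 𝒜 := by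
  rw [mem_fib, mem_famMap]
  have h : (e.disjSum (univ : Finset Unit)).map ((finSuccEquiv' i).trans (Equiv.optionEquivSumPUnit.{0, 0} (Fin n))).symm.toEmbedding
      = insert i (e.map (Fin.succAboveEmb i)) := by
    ext x; rw [mem_map_splitAt_symm, mem_insert]; simp [or_comm]
  rw [h]

/-- **Peeling at an arbitrary coordinate** (this work).  If the jump set of `𝒜` at `i` (`𝒜_i¹ ∖ 𝒜_i⁰`) contains no complementary pair,
then `ThreeSetAntipodal` for the two layer triples at `i` implies `0 ≤ threeSetN 𝒜 ℬ 𝒞`. [this work] -/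
theorem threeSetN_nonneg_of_peel (i : Fin (n + 1)) {𝒜 ℬ 𝒞 : Finset (Finset (Fin (n + 1)))}
    (h𝒜 : IsUpperSet (𝒜 : Set (Finset (Fin (n + 1))))) (hℬ : IsUpperSet (ℬ : Set (Finset (Fin (n + 1)))))
    (h𝒞 : IsUpperSet (𝒞 : Set (Finset (Fin (n + 1)))))
    (hJ : (fib (famMap ((finSuccEquiv' i).trans (Equiv.optionEquivSumPUnit.{0, 0} (Fin n))) 𝒜) univ
            \ fib (famMap ((finSuccEquiv' i).trans (Equiv.optionEquivSumPUnit.{0, 0} (Fin n))) 𝒜) ∅)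
          ∩ (fib (famMap ((finSuccEquiv' i).trans (Equiv.optionEquivSumPUnit.{0, 0} (Fin n))) 𝒜) univ
            \ fib (famMap ((finSuccEquiv' i).trans (Equiv.optionEquivSumPUnit.{0, 0} (Fin n))) 𝒜) ∅)ᶜˢ = ∅)
    (h0 : 0 ≤ threeSetN (fib (famMap ((finSuccEquiv' i).trans (Equiv.optionEquivSumPUnit.{0, 0} (Fin n))) 𝒜) ∅)
      (fib (famMap ((finSuccEquiv' i).trans (Equiv.optionEquivSumPUnit.{0, 0} (Fin n))) ℬ) ∅)
      (fib (famMap ((finSuccEquiv' i).trans (Equiv.optionEquivSumPUnit.{0, 0} (Fin n))) 𝒞) ∅))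
    (h1 : 0 ≤ threeSetN (fib (famMap ((finSuccEquiv' i).trans (Equiv.optionEquivSumPUnit.{0, 0} (Fin n))) 𝒜) univ)
      (fib (famMap ((finSuccEquiv' i).trans (Equiv.optionEquivSumPUnit.{0, 0} (Fin n))) ℬ) univ)
      (fib (famMap ((finSuccEquiv' i).trans (Equiv.optionEquivSumPUnit.{0, 0} (Fin n))) 𝒞) univ)) :
    0 ≤ threeSetN 𝒜 ℬ 𝒞 := by
  rw [← threeSetN_famMap ((finSuccEquiv' i).trans (Equiv.optionEquivSumPUnit.{0, 0} (Fin n)))]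
  exact threeSetN_nonneg_of_fib (isUpperSet_famMap _ h𝒜) (isUpperSet_famMap _ hℬ) (isUpperSet_famMap _ h𝒞) hJ h0 h1

/-! ### Pulling a set of coordinates back along `succAbove i` -/

/-- `a ⊆ insert i (e.map (succAbove i)) ↔ (pull-back of a) ⊆ e`. [this work] -/
theorem subset_insert_map_succAbove_iff (i : Fin (n + 1)) (a : Finset (Fin (n + 1))) (e : Finset (Fin n)) :
    a ⊆ insert i (e.map (Fin.succAboveEmb i)) ↔ (univ.filter fun j => i.succAbove j ∈ a) ⊆ e := by
  constructor
  · intro h j hj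
    rw [mem_filter] at hj
    have := h hj.2
    rw [mem_insert] at this
    rcases this with hji | hmem
    · exact absurd hji (Fin.succAbove_ne i j)
    · rw [Finset.mem_map] at hmem
      obtain ⟨j', hj', hjj'⟩ := hmem
      rw [Fin.succAboveEmb_apply] at hjj'
      rwa [← Fin.succAbove_right_injective hjj']
  · intro h x hx
    rw [mem_insert]
    by_cases hxi : x = i
    · exact Or.inl hxi
    · obtain ⟨j, rfl⟩ := Fin.exists_succAbove_eq hxi
      right
      exact Finset.mem_map.2 ⟨j, h (mem_filter.2 ⟨mem_univ _, hx⟩), rfl⟩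

/-- If `i ∉ a`: `a ⊆ e.map (succAbove i) ↔ (pull-back of a) ⊆ e`. [this work] -/
theorem subset_map_succAbove_iff (i : Fin (n + 1)) {a : Finset (Fin (n + 1))} (hi : i ∉ a) (e : Finset (Fin n)) :
    a ⊆ e.map (Fin.succAboveEmb i) ↔ (univ.filter fun j => i.succAbove j ∈ a) ⊆ e := by
  rw [← subset_insert_map_succAbove_iff]
  constructor
  · exact fun h => h.trans (subset_insert _ _)
  · intro h x hx
    have := h hx
    rw [mem_insert] at this
    rcases this with rfl | hmem
    · exact absurd hx hi
    · exact hmem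

/-- If `i ∈ a` then `a` is not inside any `e.map (succAbove i)`. [this work] -/
theorem not_subset_map_succAbove (i : Fin (n + 1)) {a : Finset (Fin (n + 1))} (hi : i ∈ a) (e : Finset (Fin n)) :
    ¬ a ⊆ e.map (Fin.succAboveEmb i) := by
  intro h
  obtain ⟨j, _, hj⟩ := Finset.mem_map.1 (h hi)
  exact Fin.succAbove_ne i j hj

/-- The pull-back of `a` has at most `#a` elements. [this work] -/
theorem card_pull_le (i : Fin (n + 1)) (a : Finset (Fin (n + 1))) : #(univ.filter fun j => i.succAbove j ∈ a) ≤ #a := by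
  have h : (univ.filter fun j => i.succAbove j ∈ a).map (Fin.succAboveEmb i) ⊆ a := by
    intro x hx
    obtain ⟨j, hj, rfl⟩ := Finset.mem_map.1 hx
    exact (mem_filter.1 hj).2
  simpa using card_le_card h

/-- If `a` has two elements then its pull-back along `succAbove i` is nonempty. [this work] -/
theorem pull_nonempty_of_two_le (i : Fin (n + 1)) {a : Finset (Fin (n + 1))} (ha : 2 ≤ #a) :
    (univ.filter fun j => i.succAbove j ∈ a).Nonempty := by
  have : (a.erase i).Nonempty := by
    rw [← card_pos]; have := card_erase_le (s := a) (a := i); have := pred_card_le_card_erase (s := a) (a := i); omega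
  obtain ⟨x, hx⟩ := this
  rw [mem_erase] at hx
  obtain ⟨j, rfl⟩ := Fin.exists_succAbove_eq hx.1
  exact ⟨j, mem_filter.2 ⟨mem_univ _, hx.2⟩⟩

end Peel

/-! ### Up-sets with at most two minimal elements -/

section TwoGen

/-- Membership in the two-generator family `{S : a ⊆ S ∨ b ⊆ S}` (written as a filter; no new definition). [this work] -/
theorem mem_twoGen {n : ℕ} {a b S : Finset (Fin n)} : S ∈ (univ.filter fun S : Finset (Fin n) => a ⊆ S ∨ b ⊆ S) ↔ a ⊆ S ∨ b ⊆ S := by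
  rw [mem_filter]; simp only [mem_univ, true_and]

/-- The two-generator family is an up-set. [this work] -/
theorem isUpperSet_twoGen {n : ℕ} (a b : Finset (Fin n)) :
    IsUpperSet (((univ.filter fun S : Finset (Fin n) => a ⊆ S ∨ b ⊆ S) : Finset (Finset (Fin n))) : Set (Finset (Fin n))) := by
  intro S S' hSS' hS
  rw [Finset.mem_coe, mem_twoGen] at hS ⊢
  rcases hS with h | h
  · exact Or.inl (h.trans hSS')
  · exact Or.inr (h.trans hSS')

/-- Symmetry of the two-generator family. [this work] -/
theorem twoGen_comm {n : ℕ} (a b : Finset (Fin n)) :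
    (univ.filter fun S : Finset (Fin n) => a ⊆ S ∨ b ⊆ S) = (univ.filter fun S : Finset (Fin n) => b ⊆ S ∨ a ⊆ S) := by
  ext S; rw [mem_twoGen, mem_twoGen, or_comm]

/-- If the generators meet, the family is complement-free. [this work] -/
theorem twoGen_inter_compls {n : ℕ} {a b : Finset (Fin n)} (ha : a.Nonempty) (hb : b.Nonempty) (hab : (a ∩ b).Nonempty) :
    (univ.filter fun S : Finset (Fin n) => a ⊆ S ∨ b ⊆ S) ∩ (univ.filter fun S : Finset (Fin n) => a ⊆ S ∨ b ⊆ S)ᶜˢ = ∅ := by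
  refine eq_empty_of_forall_notMem fun S hS => ?_
  rw [mem_inter, mem_compls, mem_twoGen, mem_twoGen] at hS
  obtain ⟨x, hx⟩ := hab
  rw [mem_inter] at hx
  obtain ⟨y, hy⟩ := ha
  obtain ⟨z, hz⟩ := hb
  rcases hS with ⟨h1 | h1, h2 | h2⟩
  · exact absurd (h1 hy) (mem_compl.1 (h2 hy))
  · exact absurd (h1 hx.1) (mem_compl.1 (h2 hx.2))
  · exact absurd (h1 hx.2) (mem_compl.1 (h2 hx.1))
  · exact absurd (h1 hz) (mem_compl.1 (h2 hz))

/-- **`ThreeSetAntipodal` for up-sets with at most two minimal elements** (this work, unconditional): for all `n`, all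
`a, b ⊆ [n]` and all up-sets `ℬ, 𝒞 ⊆ 2^[n]`, `0 ≤ threeSetN {S : a ⊆ S ∨ b ⊆ S} ℬ 𝒞`.  Proof by peeling (see the module doc). [this work] -/
theorem threeSetN_twoGen_nonneg : ∀ (n : ℕ) (a b : Finset (Fin n)) (ℬ 𝒞 : Finset (Finset (Fin n))),
    IsUpperSet (ℬ : Set (Finset (Fin n))) → IsUpperSet (𝒞 : Set (Finset (Fin n))) →
    0 ≤ threeSetN (univ.filter fun S : Finset (Fin n) => a ⊆ S ∨ b ⊆ S) ℬ 𝒞 := by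
  intro n
  induction n with
  | zero =>
    intro a b ℬ 𝒞 hℬ h𝒞
    -- on the empty ground set `a = b = ∅`, the family is `univ`
    have h0 : (univ.filter fun S : Finset (Fin 0) => a ⊆ S ∨ b ⊆ S) = univ :=
      eq_univ_of_forall fun S => by
        rw [mem_twoGen]; left; rw [Finset.eq_empty_of_isEmpty a]; exact empty_subset _
    rw [h0]; exact threeSetN_nonneg_univ_left hℬ h𝒞
  | succ n ih =>
    -- reduce to `#b ≤ #a` by symmetry
    suffices key : ∀ (a b : Finset (Fin (n + 1))) (ℬ 𝒞 : Finset (Finset (Fin (n + 1)))), #b ≤ #a →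
        IsUpperSet (ℬ : Set (Finset (Fin (n + 1)))) → IsUpperSet (𝒞 : Set (Finset (Fin (n + 1)))) →
        0 ≤ threeSetN (univ.filter fun S : Finset (Fin (n + 1)) => a ⊆ S ∨ b ⊆ S) ℬ 𝒞 by
      intro a b ℬ 𝒞 hℬ h𝒞
      rcases le_total #b #a with h | h
      · exact key a b ℬ 𝒞 h hℬ h𝒞
      · rw [twoGen_comm]; exact key b a ℬ 𝒞 h hℬ h𝒞
    intro a b ℬ 𝒞 hba hℬ h𝒞
    have hup := isUpperSet_twoGen a b
    -- degenerate cases: `b = ∅` (then the family is `univ`), or `a ∩ b ≠ ∅` (complement-free)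
    by_cases hb : b = ∅
    · have hu : (univ.filter fun S : Finset (Fin (n + 1)) => a ⊆ S ∨ b ⊆ S) = univ :=
        eq_univ_of_forall fun S => by rw [mem_twoGen, hb]; exact Or.inr (empty_subset _)
      rw [hu]; exact threeSetN_nonneg_univ_left hℬ h𝒞
    have hbne : b.Nonempty := nonempty_iff_ne_empty.2 hb
    have hane : a.Nonempty := by rw [← card_pos]; have := hbne.card_pos; omega
    by_cases hab : (a ∩ b).Nonempty
    · exact threeSetN_nonneg_of_inter_compls_eq_empty hup hℬ h𝒞 (twoGen_inter_compls hane hbne hab)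
    rw [not_nonempty_iff_eq_empty] at hab
    -- peel a coordinate `i ∈ a`
    obtain ⟨i, hia⟩ := hane
    have hib : i ∉ b := fun h => by
      have : i ∈ a ∩ b := mem_inter.2 ⟨hia, h⟩
      rw [hab] at this; exact notMem_empty _ this
    -- the pulled-back generators on `Fin n`
    set a' : Finset (Fin n) := univ.filter fun j => i.succAbove j ∈ a with ha'
    set b' : Finset (Fin n) := univ.filter fun j => i.succAbove j ∈ b with hb'
    -- the two layers
    have hL0 : fib (famMap ((finSuccEquiv' i).trans (Equiv.optionEquivSumPUnit.{0, 0} (Fin n)))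
        (univ.filter fun S : Finset (Fin (n + 1)) => a ⊆ S ∨ b ⊆ S)) (∅ : Finset Unit)
        = univ.filter fun S : Finset (Fin n) => b' ⊆ S ∨ b' ⊆ S := by
      ext e
      rw [mem_fib_splitAt_empty, mem_twoGen, mem_twoGen, subset_map_succAbove_iff i hib, or_self]
      constructor
      · rintro (h | h)
        · exact absurd h (not_subset_map_succAbove i hia e)
        · exact h
      · exact Or.inr
    have hL1 : fib (famMap ((finSuccEquiv' i).trans (Equiv.optionEquivSumPUnit.{0, 0} (Fin n)))
        (univ.filter fun S : Finset (Fin (n + 1)) => a ⊆ S ∨ b ⊆ S)) (univ : Finset Unit)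
        = univ.filter fun S : Finset (Fin n) => a' ⊆ S ∨ b' ⊆ S := by
      ext e
      rw [mem_fib_splitAt_univ, mem_twoGen, mem_twoGen, subset_insert_map_succAbove_iff]
      have : b ⊆ insert i (e.map (Fin.succAboveEmb i)) ↔ b' ⊆ e := by
        rw [← subset_map_succAbove_iff i hib]
        constructor
        · intro h x hx
          have := h hx; rw [mem_insert] at this
          rcases this with rfl | hmem
          · exact absurd hx hib
          · exact hmem
        · exact fun h => h.trans (subset_insert _ _)
      rw [this]
    refine threeSetN_nonneg_of_peel i hup hℬ h𝒞 ?_ ?_ ?_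
    · -- the jump set `{a' ⊆ e, b' ⊄ e}` is complement-free: `a' ≠ ∅`, or `#b' ≤ 1`
      show (fib _ univ \ fib _ ∅) ∩ (fib _ univ \ fib _ ∅)ᶜˢ = ∅
      rw [hL0, hL1]
      refine eq_empty_of_forall_notMem fun e he => ?_
      rw [mem_inter, mem_compls, mem_sdiff, mem_sdiff, mem_twoGen, mem_twoGen, mem_twoGen, mem_twoGen, or_self, or_self] at he
      obtain ⟨⟨h1, h2⟩, h3, h4⟩ := he
      have ha'e : a' ⊆ e := h1.resolve_right h2
      have ha'c : a' ⊆ eᶜ := h3.resolve_right h4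
      by_cases h2a : 2 ≤ #a
      · obtain ⟨j, hj⟩ := pull_nonempty_of_two_le i h2a
        exact absurd (ha'e hj) (mem_compl.1 (ha'c hj))
      · -- `#a = 1`, so `#b = 1` and `#b' ≤ 1`: `b' ⊄ e` and `b' ⊄ eᶜ` is impossible
        have hb1 : #b' ≤ 1 := (card_pull_le i b).trans (by omega)
        rcases Nat.lt_or_ge #b' 1 with h0 | h1'
        · have : b' = ∅ := card_eq_zero.1 (by omega)
          exact h2 (by rw [this]; exact empty_subset _)
        · obtain ⟨x, hx⟩ := card_eq_one.1 (le_antisymm hb1 h1')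
          by_cases hxe : x ∈ e
          · exact h2 (by rw [hx]; exact singleton_subset_iff.2 hxe)
          · exact h4 (by rw [hx]; exact singleton_subset_iff.2 (mem_compl.2 hxe))
    · show 0 ≤ threeSetN (fib _ ∅) (fib _ ∅) (fib _ ∅)
      rw [hL0]
      exact ih b' b' _ _ (isUpperSet_fib (isUpperSet_famMap _ hℬ) _) (isUpperSet_fib (isUpperSet_famMap _ h𝒞) _)
    · show 0 ≤ threeSetN (fib _ univ) (fib _ univ) (fib _ univ)
      rw [hL1]
      exact ih a' b' _ _ (isUpperSet_fib (isUpperSet_famMap _ hℬ) _) (isUpperSet_fib (isUpperSet_famMap _ h𝒞) _)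

/-- Packaged form: `ThreeSetAntipodal` holds whenever `𝒜` has at most two minimal elements, i.e. `S ∈ 𝒜 ↔ a ⊆ S ∨ b ⊆ S` for some
`a, b` (take `a = b` for a principal up-set). [this work] -/
theorem threeSetN_nonneg_of_twoGen {n : ℕ} {𝒜 ℬ 𝒞 : Finset (Finset (Fin n))} (a b : Finset (Fin n))
    (h𝒜 : ∀ S, S ∈ 𝒜 ↔ a ⊆ S ∨ b ⊆ S) (hℬ : IsUpperSet (ℬ : Set (Finset (Fin n))))
    (h𝒞 : IsUpperSet (𝒞 : Set (Finset (Fin n)))) : 0 ≤ threeSetN 𝒜 ℬ 𝒞 := by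
  have h : 𝒜 = univ.filter fun S : Finset (Fin n) => a ⊆ S ∨ b ⊆ S := by
    ext S; rw [h𝒜 S, mem_twoGen]
  rw [h]; exact threeSetN_twoGen_nonneg n a b ℬ 𝒞 hℬ h𝒞

end TwoGen

end Summit.CriticalPhenomena.PercolationContinuityZ3.Theorems.TwoPartition
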